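import Literature.Computability.AlgebraicComplexity.CharacterizedByStabilizer
import Literature.Computability.AlgebraicComplexity.PerStabilizerMarcusMayProofs
import Mathlib.LinearAlgebra.Matrix.GeneralLinearGroup.Defs
import Mathlib.LinearAlgebra.Matrix.ToLin
import Mathlib.GroupTheory.Perm.Cycle.Type
import Mathlib.Data.Int.Order.Units
import Mathlib.Algebra.MvPolynomial.Funext
import HarnessLib

/-!
# The `SL`-reading of "perm is characterized by its stabilizer" (GCT II, Thm. 2.3) fails for `n ≡ 1 (mod 4)`

Topic `Literature/Computability/AlgebraicComplexity` (geometric complexity theory; cell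
`pub-gct-max`, track T "typed chain", seat lit-1; companion of `CharacterizedByStabilizer.lean`).
Honest framing of that cell: multiplicity data and certified rank bounds at small parameters;
occurrence obstructions are ruled out in print (BIP'16) — multiplicity obstructions are the open
door; nothing here is a claim on VP vs VNP or P vs NP.

## What is printed, and the two readings

Mulmuley–Sohoni, GCT II (SIAM J. Comput. 38 (2008); arXiv:cs/0612134), §1, define: "`v` is
characterized by its stabilizer, if `V^{G_v̂}`, the set of points in `V` stabilized by `G_v̂`, is
equal to `ℂv`", for a connected reductive `G` acting on `V`, and Theorem 2.3 (arXiv Thm. 3.3)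
asserts, for `h = perm(X) ∈ P(W)`, `W = Sym^n(X)`, `X` an `n × n` variable matrix, acted on by
"`SL(X) = SL_k(ℂ)`", `k = n²`: "Moreover, both `perm(X) ∈ P(W)` and `det(Y) ∈ P(V)` are
characterized by their stabilizers. Hence, both `h` and `g` are excellent. … The stabilizer of
`perm(X)` in `SL_{n²}(ℂ)` is generated [minc] by linear transformations of the form
`X → λ X μ^{-1}` … where `λ` and `μ` are either diagonal or permutation matrices."
[cite: MulmuleySohoniGCT2SIAM2008, §1 (definition) and Thm. 2.3]. The GCT Introduction
(arXiv:0709.0746, Lecture 13, Prop. [GCT1]) states the same with `G = GL_n(ℂ)`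
[cite: MulmuleySohoniGCTIntro2007, Lecture 13], as does Landsberg, *Geometry and Complexity
Theory* (2017), Def. 1.2.5.3 (`G_p ⊆ GL_N`). [cite: Landsberg2017, Def. 1.2.5.3]

`CharacterizedByStabilizer.lean` vendors the notion with the acting group as a parameter,
`IsCharacterizedByStabilizerIn G f m` (`G ≤ GL σ k`), PROVES the `GL`-reading for `det_m`, `per_n`
and the padded permanent, and records (module docstring) that the `SL(Y)`-reading — a *stronger*
statement, the property being antitone in the fixed space and monotone in `G`
(`IsCharacterizedByStabilizerIn.mono`) — is not vendored. This file settles the `SL`-reading for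
the permanent itself in the residue class where it is FALSE, as a theorem (no named fact):

* `slSubgroup σ k ≤ GL σ k` — the special linear group as a subgroup of the tree's acting group
  (the range of Mathlib's `Matrix.SpecialLinearGroup.toGL`; `mem_slSubgroup_iff : det γ = 1`).
* `linSubstRep_detPoly_eq_of_det_eq_one_of_perPoly` — for `n ≥ 3` with `n ≡ 1 (mod 4)`, every
  `γ ∈ GL_{n²}(ℂ)` with `det γ = 1` that fixes `per_n` also fixes `det_n`.
* `detPoly_mem_fixedForms_slSubgroup_perPoly`, `span_pair_le_fixedForms_slSubgroup_perPoly` — hence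
  `W^{SL_{n²} ∩ Stab(per_n)} ⊇ ⟨per_n, det_n⟩`, and
* `not_isCharacterizedByStabilizerIn_slSubgroup_perPoly` — `per_n` is NOT characterized by its
  stabilizer in `SL_{n²}(ℂ)` in the sense of GCT II §1 when `n ≡ 1 (mod 4)`, `n ≥ 5`
  (`detPoly_ne_smul_perPoly`: `det_n ∉ ℂ per_n` for `n ≥ 2`);
* `isCharacterizedByStabilizerIn_slSubgroup_perPoly` (`n ≢ 1 (mod 4)`: it IS),
  `isCharacterizedByStabilizerIn_slSubgroup_perPoly_iff` (`n ≥ 2`: iff `n ≢ 1 (mod 4)`),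
  `fixedForms_slSubgroup_perPoly_eq`;
* `isCharacterizedByStabilizerIn_slSubgroup_detPoly`, `fixedForms_slSubgroup_detPoly_eq` — the
  determinant IS characterized by its stabilizer in `SL_{m²}(ℂ)`, every `m` (as printed).
* `isCharacterizedByStabilizerIn_slSubgroup_paddedPerPoly`, `fixedForms_slSubgroup_paddedPerPoly_eq` —
  so is the padded permanent `X₀₀^{m−n} per_n`, `n < m`, `m ≥ 3`.

So the clause of Thm. 2.3 about `perm(X)` holds in the `GL(X)`-reading of the Introduction
(`perPoly_isCharacterizedByStabilizer_holds`) but not literally with `G = SL(X)` for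
`n = 5, 9, 13, …`. In the other residues (`n` even, or `n ≡ 3 (mod 4)`, where an odd row
permutation, resp. the index transposition composed with one, lies in `SL_{n²}`) the `SL`-reading
DOES hold: `isCharacterizedByStabilizerIn_slSubgroup_perPoly` (from the hypothesis-form theorem
`CharacterizedByStabilizer.perPoly_eq_smul_of_fixed_of_det_eq_one` of the companion file), whence
the exact statement `isCharacterizedByStabilizerIn_slSubgroup_perPoly_iff` (`n ≥ 2`: the
`SL`-reading holds iff `n ≢ 1 (mod 4)`) and `fixedForms_slSubgroup_perPoly_eq`. The
`SL(Y)`-reading for the DETERMINANT (`g = det(Y) ∈ P(V)`, the clause that makes `Δ_V[g]`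
group-theoretic) holds literally for every `m`: `isCharacterizedByStabilizerIn_slSubgroup_detPoly`,
`fixedForms_slSubgroup_detPoly_eq` (from `CharacterizedByStabilizer.detPoly_eq_smul_of_fixed_of_det_eq_one`).
The `SL_{m²}`-reading for the padded permanent `X₀₀^{m−n} per_n` of Thm. 2.3's `f = φ(h)` ("only
almost excellent–because its defect of partial stability is one") also holds literally, for `n < m`,
`m ≥ 3`: `isCharacterizedByStabilizerIn_slSubgroup_paddedPerPoly`, `fixedForms_slSubgroup_paddedPerPoly_eq`
(from `CharacterizedByStabilizer.paddedPerPoly_eq_smul_of_fixed_of_det_eq_one`: determinant-one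
scalings of pairs of the variables absent from `X₀₀^{m−n} per_n` reduce it to the `GL` statement).

## The argument (elementary, given Marcus–May)

By the Marcus–May permanent-preserver theorem (tree: `marcusMay1962_perPreserver_sandwich_holds`,
`PerStabilizerMarcusMayProofs.lean`) an element `γ` of the stabilizer of `per_n`, `n ≥ 3`, acts on
matrices as `X ↦ D P_π X^{(T)} P_ρ L` with `D = diag d`, `L = diag l`, `(∏ d)(∏ l) = 1`
[cite: MarcusMay1962, §2 Theorem, p. 179]. Such a map multiplies `det_n` by `sgn π · sgn ρ`
(`det Xᵀ = det X`), and as a linear map of `ℂ^{n×n}` it is the monomial matrix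
`diag(d_a l_b) · P_θ`, `θ = (a, b) ↦ (π a, ρ⁻¹ b)` possibly followed by the index swap
`(a, b) ↦ (b, a)`; its determinant is `((∏ d)(∏ l))^n · sgn(π)^n sgn(ρ)^n · [sgn(swap)]`
`= sgn π · sgn ρ · [(−1)^{n(n−1)/2}]` for odd `n` (`sign_swapPerm_of_mod_four_eq_one`: the swap is an
involution of `n²` points with `n` fixed points). For `n ≡ 1 (mod 4)` the bracket is `+1`, so `det γ = 1` forces
`sgn π = sgn ρ`, i.e. `γ` fixes `det_n`. (Own elementary computation of this seat, recorded in the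
cell file `typed/AS-PRINTED-1.md` §0 as a warning since gen 2 and certified here; no published
source states it — presearch: corpus + galaxy, "characterized by its stabilizer", 2026-08-23.)
[folklore]
-/

noncomputable section

open MvPolynomial Finset Matrix

namespace Literature.Computability.AlgebraicComplexity

universe u v

section SL

variable (σ : Type v) (k : Type u) [Fintype σ] [DecidableEq σ] [CommRing k]

/-- The special linear group `SL(Y) = SL_l(ℂ)` of GCT II ("with the natural action of
`G = SL(Y) = SL_l(ℂ)`, and `Ĝ = GL(Y)`") as a subgroup of the tree's acting group `GL σ k` of
linear substitutions: the range of Mathlib's embedding `Matrix.SpecialLinearGroup.toGL`.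
[cite: MulmuleySohoniGCT2SIAM2008, §2 (the groups `G = SL(Y)`, `Ĝ = GL(Y)`)] -/
def slSubgroup : Subgroup (GL σ k) :=
  (Matrix.SpecialLinearGroup.toGL : Matrix.SpecialLinearGroup σ k →* GL σ k).range

variable {σ k}

/-- Membership in `slSubgroup`: the underlying matrix has determinant `1` (GCT II's `G = SL(Y)` inside
`Ĝ = GL(Y)`). [cite: MulmuleySohoniGCT2SIAM2008, §2 (the groups `G = SL(Y)`, `Ĝ = GL(Y)`)] -/
theorem mem_slSubgroup_iff {γ : GL σ k} :
    γ ∈ slSubgroup σ k ↔ Matrix.det (γ : Matrix σ σ k) = 1 := by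
  rw [slSubgroup, MonoidHom.mem_range]
  constructor
  · rintro ⟨g, rfl⟩
    exact g.det_coe
  · intro h
    exact ⟨⟨(γ : Matrix σ σ k), h⟩, Units.ext rfl⟩

end SL

namespace CharacterizedByStabilizerSL

/-! ## Index permutations of a monomial sandwich and their signs -/

variable {n : ℕ}

/-- The permutation `(a, b) ↦ (π a, ρ⁻¹ b)` of the matrix positions `Fin n × Fin n` induced by the
sandwich `X ↦ P_π X P_ρ` (`(P_π X P_ρ)_{ab} = X_{π a, ρ⁻¹ b}`). [folklore] -/
def sandwichPerm (π ρ : Equiv.Perm (Fin n)) : Equiv.Perm (Fin n × Fin n) :=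
  (Equiv.prodCongrLeft fun _ : Fin n => π) * (Equiv.prodCongrRight fun _ : Fin n => ρ.symm)

/-- `sandwichPerm π ρ (a, b) = (π a, ρ⁻¹ b)`. [folklore] -/
@[simp] private theorem sandwichPerm_apply (π ρ : Equiv.Perm (Fin n)) (p : Fin n × Fin n) :
    sandwichPerm π ρ p = (π p.1, ρ.symm p.2) := by
  rcases p with ⟨a, b⟩
  simp [sandwichPerm, Equiv.Perm.mul_apply]

/-- `sgn` of `(a, b) ↦ (π a, ρ⁻¹ b)` on `n × n` positions is `sgn(π)^n · sgn(ρ)^n`, `= sgn π · sgn ρ`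
for odd `n` (stated for odd `n` only, which is all that is used). [folklore] -/
private theorem sign_sandwichPerm (hn : Odd n) (π ρ : Equiv.Perm (Fin n)) :
    Equiv.Perm.sign (sandwichPerm π ρ) = Equiv.Perm.sign π * Equiv.Perm.sign ρ := by
  unfold sandwichPerm
  rw [map_mul, Equiv.Perm.sign_prodCongrLeft, Equiv.Perm.sign_prodCongrRight, Finset.prod_const,
    Finset.prod_const, Finset.card_univ, Fintype.card_fin, Equiv.Perm.sign_symm,
    Int.units_pow_eq_pow_mod_two (Equiv.Perm.sign π) n,
    Int.units_pow_eq_pow_mod_two (Equiv.Perm.sign ρ) n, Nat.odd_iff.mp hn, pow_one, pow_one]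

/-- The index swap `(a, b) ↦ (b, a)` (transposition of matrices) as a permutation of
`Fin n × Fin n`. [folklore] -/
def swapPerm (n : ℕ) : Equiv.Perm (Fin n × Fin n) := Equiv.prodComm (Fin n) (Fin n)

/-- `swapPerm n (a, b) = (b, a)`. [folklore] -/
@[simp] private theorem swapPerm_apply (p : Fin n × Fin n) : swapPerm n p = (p.2, p.1) := rfl

/-- The index swap is an involution of the `n²` positions with exactly the `n` diagonal fixed
points, so its sign is `(−1)^{(n² − n)/2}`; for `n ≡ 1 (mod 4)`, `(n² − n)/2 = 2k(4k+1)` is even and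
the swap is an even permutation. [folklore] -/
private theorem sign_swapPerm_of_mod_four_eq_one (h1 : n % 4 = 1) :
    Equiv.Perm.sign (swapPerm n) = 1 := by
  have hsq : swapPerm n ^ 2 = 1 := by
    ext p <;> simp [pow_two, Equiv.Perm.mul_apply]
  have hfp : Fintype.card (Function.fixedPoints (swapPerm n)) = n := by
    let e : Function.fixedPoints (swapPerm n) ≃ Fin n :=
      { toFun := fun p => p.1.1
        invFun := fun i => ⟨(i, i), Function.mem_fixedPoints_iff.mpr rfl⟩
        left_inv := by
          rintro ⟨⟨a, b⟩, hp⟩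
          have hba : b = a := by
            have := congrArg Prod.fst (Function.mem_fixedPoints_iff.mp hp)
            simpa using this
          subst hba
          rfl
        right_inv := fun i => rfl }
    simpa using Fintype.card_congr e
  obtain ⟨q, hq⟩ : ∃ q, n = 4 * q + 1 := ⟨n / 4, by omega⟩
  have hsub : n * n - n = 2 * (2 * (q * (4 * q + 1))) := by
    subst hq
    apply Nat.sub_eq_of_eq_add
    ring
  have hdiv : (Fintype.card (Fin n × Fin n) -
      Fintype.card (Function.fixedPoints (swapPerm n))) / 2 = 2 * (q * (4 * q + 1)) := by
    rw [hfp, Fintype.card_prod, Fintype.card_fin, hsub, Nat.mul_div_cancel_left _ two_pos]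
  rw [Equiv.Perm.sign_of_pow_two_eq_one hsq, hdiv, pow_mul, Int.units_sq, one_pow]

/-! ## Entries and determinant of a monomial sandwich -/

/-- Entries of a monomial sandwich: `(D P_π X P_ρ L)_{ab} = d_a · X_{π a, ρ⁻¹ b} · l_b`
(Mathlib's `permMatrix`: `(P_π X)_{ab} = X_{π a, b}`, `(X P_ρ)_{ab} = X_{a, ρ⁻¹ b}`). [folklore] -/
private theorem sandwich_apply {ι R : Type*} [Fintype ι] [DecidableEq ι] [CommRing R]
    (d l : ι → R) (π ρ : Equiv.Perm ι) (X : Matrix ι ι R) (a b : ι) :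
    (diagonal d * π.permMatrix R * X * ρ.permMatrix R * diagonal l) a b =
      d a * X (π a) (ρ.symm b) * l b := by
  rw [Matrix.mul_diagonal, PEquiv.mul_toMatrix_toPEquiv, Matrix.submatrix_apply, id,
    Matrix.mul_assoc, Matrix.diagonal_mul, PEquiv.toMatrix_toPEquiv_mul, Matrix.submatrix_apply, id]

/-- A square matrix `M` whose transpose acts on coordinate vectors as a weighted index
permutation, `(Mᵀ v)_p = w_p · v_{θ p}`, is (the transpose of) the monomial matrix
`diag(w) · P_θ`, so `det M = (∏ w) · sgn θ`. [folklore] -/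
private theorem det_eq_of_transpose_mulVec {τ R : Type*} [Fintype τ] [DecidableEq τ] [CommRing R]
    (M : Matrix τ τ R) (w : τ → R) (θ : Equiv.Perm τ)
    (h : ∀ (v : τ → R) (p : τ), (Mᵀ *ᵥ v) p = w p * v (θ p)) :
    M.det = (∏ p, w p) * (((Equiv.Perm.sign θ : ℤˣ) : ℤ) : R) := by
  have hM : Mᵀ = diagonal w * θ.permMatrix R := by
    refine Matrix.toLin'.injective (LinearMap.ext fun v => ?_)
    rw [Matrix.toLin'_apply, Matrix.toLin'_apply, ← Matrix.mulVec_mulVec, Matrix.permMatrix_mulVec]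
    funext p
    rw [h v p, Matrix.mulVec_diagonal, Function.comp_apply]
  rw [← Matrix.det_transpose, hM, Matrix.det_mul, Matrix.det_diagonal, Matrix.det_permutation]

/-- `∏_{(a,b)} d_a l_b = ((∏ d)(∏ l))^n` over `Fin n × Fin n`; `= 1` under the Marcus–May
normalisation. [folklore] -/
private theorem prod_weights_eq_one {d l : Fin n → ℂ} (hdl : (∏ i, d i) * (∏ i, l i) = 1) :
    (∏ p : Fin n × Fin n, d p.1 * l p.2) = 1 := by
  rw [Fintype.prod_prod_type]
  simp only [Finset.prod_mul_distrib, Finset.prod_const, Finset.card_univ, Fintype.card_fin,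
    Finset.prod_pow]
  rw [← mul_pow, hdl, one_pow]

/-- Evaluating a linear substitution: `(M · f)(x) = f(Mᵀ x)` (as `MarcusMoyls.eval_linSubst` /
the private `MarcusMay.eval_linSubst`; repeated to keep imports small). [folklore] -/
private theorem eval_linSubst {σ : Type*} [Fintype σ] (M : Matrix σ σ ℂ) (x : σ → ℂ)
    (f : MvPolynomial σ ℂ) : eval x (linSubst σ ℂ M f) = eval (Mᵀ *ᵥ x) f := by
  induction f using MvPolynomial.induction_on with
  | C a => rw [linSubst_C, eval_C, eval_C]
  | add p q hp hq => rw [map_add, map_add, map_add, hp, hq]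
  | mul_X p i hp =>
    rw [map_mul, map_mul, map_mul, hp, linSubst_X, eval_X]
    congr 1
    simp [Matrix.mulVec, dotProduct, smul_eval]

/-! ## The stabilizer of `per_n` inside `SL_{n²}` fixes `det_n` when `n ≡ 1 (mod 4)` -/

/-- **Main lemma.** For `n ≥ 3`, `n ≡ 1 (mod 4)`: an invertible linear substitution of
determinant `1` that fixes the generic permanent `per_n` fixes the generic determinant `det_n`
(Marcus–May sandwich form; `det`-multiplier `sgn π sgn ρ`; `det γ = sgn π sgn ρ (−1)^{[T] n(n−1)/2}`).
[cite: MarcusMay1962, §2 Theorem, p. 179] (the stabilizer); the conclusion is this file's own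
elementary computation. -/
theorem linSubstRep_detPoly_eq_of_det_eq_one_of_perPoly (h3 : 3 ≤ n) (h1 : n % 4 = 1)
    {γ : GL (Fin n × Fin n) ℂ}
    (hdet : Matrix.det (γ : Matrix (Fin n × Fin n) (Fin n × Fin n) ℂ) = 1)
    (hper : linSubstRep (Fin n × Fin n) ℂ γ (perPoly (Fin n) ℂ) = perPoly (Fin n) ℂ) :
    linSubstRep (Fin n × Fin n) ℂ γ (detPoly (Fin n) ℂ) = detPoly (Fin n) ℂ := by
  obtain ⟨π, ρ, d, l, hdl, hcase⟩ :=
    marcusMay1962_perPreserver_sandwich_holds.of_mem_linStabilizer h3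
      ((mem_linStabilizer (f := perPoly (Fin n) ℂ)).mpr hper)
  have hodd : Odd n := Nat.odd_iff.mpr (by omega)
  -- the scalar by which `γ` multiplies `det_n`
  set ε : ℂ := (((Equiv.Perm.sign π : ℤˣ) : ℤ) : ℂ) * (((Equiv.Perm.sign ρ : ℤˣ) : ℤ) : ℂ)
    with hε
  -- (1) `γ · det = ε det`, pointwise
  have key : ∀ x : Fin n × Fin n → ℂ,
      eval x (linSubst (Fin n × Fin n) ℂ (γ : Matrix (Fin n × Fin n) (Fin n × Fin n) ℂ)
        (detPoly (Fin n) ℂ)) = ε * eval x (detPoly (Fin n) ℂ) := by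
    intro x
    rw [eval_linSubst, eval_detPoly, eval_detPoly]
    rcases hcase with hM | hM
    · rw [hM x]
      simp only [Matrix.det_mul, Matrix.det_diagonal, Matrix.det_permutation, hε]
      linear_combination ((((Equiv.Perm.sign π : ℤˣ) : ℤ) : ℂ) *
        (((Equiv.Perm.sign ρ : ℤˣ) : ℤ) : ℂ) * (Matrix.of fun a b => x (a, b)).det) * hdl
    · rw [hM x]
      simp only [Matrix.det_mul, Matrix.det_diagonal, Matrix.det_permutation, Matrix.det_transpose,
        hε]
      linear_combination ((((Equiv.Perm.sign π : ℤˣ) : ℤ) : ℂ) *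
        (((Equiv.Perm.sign ρ : ℤˣ) : ℤ) : ℂ) * (Matrix.of fun a b => x (a, b)).det) * hdl
  -- (2) `det γ = ε · [sgn swap]`, hence `ε = 1`
  have hε1 : ε = 1 := by
    rcases hcase with hM | hM
    · -- no transpose: `Mᵀ v = (d_a l_b) · v ∘ θ`, `θ = sandwichPerm π ρ`
      have hact : ∀ (v : Fin n × Fin n → ℂ) (p : Fin n × Fin n),
          ((γ : Matrix (Fin n × Fin n) (Fin n × Fin n) ℂ)ᵀ *ᵥ v) p =
            (d p.1 * l p.2) * v (sandwichPerm π ρ p) := by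
        rintro v ⟨a, b⟩
        have := congr_fun (congr_fun (hM v) a) b
        rw [sandwich_apply] at this
        simp only [Matrix.of_apply] at this
        rw [this, sandwichPerm_apply]
        dsimp only
        ring
      have hd := det_eq_of_transpose_mulVec _ _ _ hact
      rw [hdet, prod_weights_eq_one hdl, one_mul, sign_sandwichPerm hodd, Units.val_mul,
        Int.cast_mul] at hd
      rw [hε, ← hd]
    · -- transpose: `θ = swapPerm n * sandwichPerm π ρ`
      have hact : ∀ (v : Fin n × Fin n → ℂ) (p : Fin n × Fin n),
          ((γ : Matrix (Fin n × Fin n) (Fin n × Fin n) ℂ)ᵀ *ᵥ v) p =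
            (d p.1 * l p.2) * v ((swapPerm n * sandwichPerm π ρ) p) := by
        rintro v ⟨a, b⟩
        have := congr_fun (congr_fun (hM v) a) b
        rw [sandwich_apply] at this
        simp only [Matrix.of_apply, Matrix.transpose_apply] at this
        rw [this, Equiv.Perm.mul_apply, sandwichPerm_apply, swapPerm_apply]
        dsimp only
        ring
      have hd := det_eq_of_transpose_mulVec _ _ _ hact
      rw [hdet, prod_weights_eq_one hdl, one_mul, map_mul, sign_swapPerm_of_mod_four_eq_one h1,
        one_mul, sign_sandwichPerm hodd, Units.val_mul, Int.cast_mul] at hd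
      rw [hε, ← hd]
  -- (3) conclude by the identity of polynomial functions (`ℂ` infinite)
  apply MvPolynomial.funext
  intro x
  rw [linSubstRep_apply, key x, hε1, one_mul]

/-- `det_n` is not a scalar multiple of `per_n` for `n ≥ 2` (evaluate at `1` and at a
transposition matrix). [folklore] -/
private theorem detPoly_ne_smul_perPoly (h2 : 2 ≤ n) (c : ℂ) :
    detPoly (Fin n) ℂ ≠ c • perPoly (Fin n) ℂ := by
  intro h
  -- evaluation at the entries of a matrix `A`
  have hev : ∀ A : Matrix (Fin n) (Fin n) ℂ,
      A.det = c * A.permanent := by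
    intro A
    have hA : (Matrix.of fun i j : Fin n => A i j) = A := Matrix.ext fun _ _ => rfl
    have := congrArg (eval fun p : Fin n × Fin n => A p.1 p.2) h
    rw [smul_eval, eval_detPoly, eval_perPoly] at this
    simpa only [hA] using this
  -- at the identity matrix: `1 = c`
  have hc1 : c = 1 := by
    have := hev 1
    rw [Matrix.det_one, Matrix.permanent_one, mul_one] at this
    exact this.symm
  -- at the transposition matrix `P_{(0 1)}`: `-1 = c`
  set a : Fin n := ⟨0, by omega⟩
  set b : Fin n := ⟨1, by omega⟩
  have hab : a ≠ b := by simp [a, b, Fin.ext_iff]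
  have h₂ := hev ((Equiv.swap a b).permMatrix ℂ)
  rw [Matrix.det_permutation, Equiv.Perm.sign_swap hab, ← Matrix.mul_one
      ((Equiv.swap a b).permMatrix ℂ), MarcusMay.permanent_permMatrix_mul, Matrix.permanent_one,
    mul_one, hc1] at h₂
  norm_num at h₂

end CharacterizedByStabilizerSL

open CharacterizedByStabilizerSL

variable {n : ℕ}

/-- **`det_n ∈ W^{SL_{n²} ∩ Stab(per_n)}`** for `n ≥ 3`, `n ≡ 1 (mod 4)`: the generic determinant
is a degree-`n` form fixed by every determinant-one substitution fixing `per_n`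
(GCT II §1's `V^{G_v̂}` with `G = SL(X)`, `v̂ = perm(X)`). [folklore] (own computation from
[cite: MarcusMay1962, §2 Theorem, p. 179]) -/
theorem detPoly_mem_fixedForms_slSubgroup_perPoly (h3 : 3 ≤ n) (h1 : n % 4 = 1) :
    detPoly (Fin n) ℂ ∈ fixedForms (slSubgroup (Fin n × Fin n) ℂ) (perPoly (Fin n) ℂ) n := by
  refine mem_fixedForms_iff.mpr ⟨by simpa using detPoly_isHomogeneous (n := Fin n) (k := ℂ), ?_⟩
  intro γ hγ hper
  exact linSubstRep_detPoly_eq_of_det_eq_one_of_perPoly h3 h1 (mem_slSubgroup_iff.mp hγ) hper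

/-- Hence `⟨per_n, det_n⟩_ℂ ⊆ W^{SL_{n²} ∩ Stab(per_n)}` (`n ≥ 3`, `n ≡ 1 (mod 4)`): the fixed space of
GCT II §1 for `G = SL(X)`, `v̂ = perm(X)` is at least two-dimensional. (Own computation from the
cited stabilizer theorem.) [cite: MarcusMay1962, §2 Theorem, p. 179]
[cite: MulmuleySohoniGCT2SIAM2008, §1 (definition of `V^{G_v̂}`)] -/
theorem span_pair_le_fixedForms_slSubgroup_perPoly (h3 : 3 ≤ n) (h1 : n % 4 = 1) :
    Submodule.span ℂ {perPoly (Fin n) ℂ, detPoly (Fin n) ℂ} ≤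
      fixedForms (slSubgroup (Fin n × Fin n) ℂ) (perPoly (Fin n) ℂ) n := by
  rw [Submodule.span_le]
  rintro p (rfl | rfl)
  · exact mem_fixedForms_iff.mpr
      ⟨by simpa using perPoly_isHomogeneous (n := Fin n) (k := ℂ), fun _ _ h => h⟩
  · exact detPoly_mem_fixedForms_slSubgroup_perPoly h3 h1

/-- **The `SL(X)`-reading of GCT II Thm. 2.3 for the permanent fails for `n ≡ 1 (mod 4)`,
`n ≥ 5`:** `per_n` is not characterized by its stabilizer in `SL_{n²}(ℂ)` in the sense of
Mulmuley–Sohoni 2008 §1 (`W^{G_ĥ} ⊋ ℂ h` since it contains `det_n`). The `GL(X)`-reading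
(`perPoly_isCharacterizedByStabilizer_holds`, GCT Introduction Lect. 13 Prop. (2)) is unaffected.
[cite: MulmuleySohoniGCT2SIAM2008, §1 (definition) and Thm. 2.3 (the statement refuted in this reading)]
(refutation: own computation from [cite: MarcusMay1962, §2 Theorem, p. 179]) -/
theorem not_isCharacterizedByStabilizerIn_slSubgroup_perPoly (h5 : 5 ≤ n) (h1 : n % 4 = 1) :
    ¬ IsCharacterizedByStabilizerIn (slSubgroup (Fin n × Fin n) ℂ) (perPoly (Fin n) ℂ) n := by
  intro h
  obtain ⟨c, hc⟩ := h (detPoly (Fin n) ℂ)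
    (by simpa using detPoly_isHomogeneous (n := Fin n) (k := ℂ))
    (fun γ hγ hper =>
      linSubstRep_detPoly_eq_of_det_eq_one_of_perPoly (by omega) h1 (mem_slSubgroup_iff.mp hγ) hper)
  exact detPoly_ne_smul_perPoly (by omega) c hc

/-- In particular for `n = 5` (`perm₅`, `SL₂₅(ℂ)`). [folklore] -/
example : ¬ IsCharacterizedByStabilizerIn (slSubgroup (Fin 5 × Fin 5) ℂ) (perPoly (Fin 5) ℂ) 5 :=
  not_isCharacterizedByStabilizerIn_slSubgroup_perPoly le_rfl rfl

/-! ## The positive half and the exact statement: the `SL`-reading holds iff `n ≢ 1 (mod 4)` -/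

/-- **For `n` even or `n ≡ 3 (mod 4)`, `per_n` IS characterized by its stabilizer in `SL_{n²}(ℂ)`**
(the `G = SL(X)` reading of GCT II Thm. 2.3 / §1, in the residues where it holds): restatement for
`slSubgroup` of `CharacterizedByStabilizer.perPoly_eq_smul_of_fixed_of_det_eq_one`
(`CharacterizedByStabilizer.lean`). Own elementary computation refining the cited statement.
[cite: MulmuleySohoniGCT2SIAM2008, §1 (definition) and Thm. 2.3 (arXiv cs/0612134 Thm. 3.3)] -/
theorem isCharacterizedByStabilizerIn_slSubgroup_perPoly (hn : n % 4 ≠ 1) :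
    IsCharacterizedByStabilizerIn (slSubgroup (Fin n × Fin n) ℂ) (perPoly (Fin n) ℂ) n :=
  fun p hp hfix => CharacterizedByStabilizer.perPoly_eq_smul_of_fixed_of_det_eq_one hn p hp
    fun γ hdet hper => hfix γ (mem_slSubgroup_iff.mpr hdet) hper

/-- `W^{SL_{n²} ∩ Stab(per_n)} = ℂ per_n` for `n ≢ 1 (mod 4)` (GCT II §1's `V^{G_v̂} = ℂv` with
`G = SL(X)`). [cite: MulmuleySohoniGCT2SIAM2008, §1 (definition) and Thm. 2.3] -/
theorem fixedForms_slSubgroup_perPoly_eq (hn : n % 4 ≠ 1) :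
    fixedForms (slSubgroup (Fin n × Fin n) ℂ) (perPoly (Fin n) ℂ) n = ℂ ∙ perPoly (Fin n) ℂ :=
  (isCharacterizedByStabilizerIn_slSubgroup_perPoly hn).fixedForms_eq
    (by simpa using perPoly_isHomogeneous (n := Fin n) (k := ℂ))

/-- **The `SL(X)`-reading of "`perm_n` is characterized by its stabilizer" holds iff
`n ≢ 1 (mod 4)`** (`n ≥ 2`; for `n = 1` it holds trivially although `1 ≡ 1`): the exact status of
the literal `G = SL(X)` reading of Mulmuley–Sohoni, GCT II, Thm. 2.3 for the permanent. Own
elementary computation (both halves in this file and its companion).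
[cite: MulmuleySohoniGCT2SIAM2008, §1 (definition) and Thm. 2.3 (arXiv cs/0612134 Thm. 3.3)] -/
theorem isCharacterizedByStabilizerIn_slSubgroup_perPoly_iff (h2 : 2 ≤ n) :
    IsCharacterizedByStabilizerIn (slSubgroup (Fin n × Fin n) ℂ) (perPoly (Fin n) ℂ) n ↔
      n % 4 ≠ 1 :=
  ⟨fun h h1 => not_isCharacterizedByStabilizerIn_slSubgroup_perPoly (by omega) h1 h,
    isCharacterizedByStabilizerIn_slSubgroup_perPoly⟩

/-! ## The determinant: the `SL(Y)`-reading holds for every `m` (as printed) -/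

/-- **`det_m` is characterized by its stabilizer in `SL_{m²}(ℂ)`, for every `m`** — GCT II Thm. 2.3
"`det(Y) ∈ P(V)` … characterized by [its] stabilizer" in its literal reading (`V = Sym^m(Y)` "with
the natural action of `G = SL(Y)`", §1: `V^{G_ĝ} = ℂg`): restatement for `slSubgroup` of
`CharacterizedByStabilizer.detPoly_eq_smul_of_fixed_of_det_eq_one`. Our proof of the printed
statement. [cite: MulmuleySohoniGCT2SIAM2008, §1 (definition) and Thm. 2.3 (arXiv cs/0612134 Thm. 3.3)] -/
theorem isCharacterizedByStabilizerIn_slSubgroup_detPoly (m : ℕ) :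
    IsCharacterizedByStabilizerIn (slSubgroup (Fin m × Fin m) ℂ) (detPoly (Fin m) ℂ) m :=
  fun p hp hfix => CharacterizedByStabilizer.detPoly_eq_smul_of_fixed_of_det_eq_one p hp
    fun γ hdet hfixdet => hfix γ (mem_slSubgroup_iff.mpr hdet) hfixdet

/-- `W^{SL_{m²} ∩ Stab(det_m)} = ℂ det_m` for every `m` (GCT II §1's `V^{G_v̂} = ℂv` with
`G = SL(Y)`, `v̂ = det(Y)`). [cite: MulmuleySohoniGCT2SIAM2008, §1 (definition) and Thm. 2.3] -/
theorem fixedForms_slSubgroup_detPoly_eq (m : ℕ) :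
    fixedForms (slSubgroup (Fin m × Fin m) ℂ) (detPoly (Fin m) ℂ) m = ℂ ∙ detPoly (Fin m) ℂ :=
  (isCharacterizedByStabilizerIn_slSubgroup_detPoly m).fixedForms_eq
    (by simpa using detPoly_isHomogeneous (n := Fin m) (k := ℂ))

/-! ## The padded permanent: the `SL(Y)`-reading holds (`n < m`, `m ≥ 3`) -/

/-- **The padded permanent `X₀₀^{m-n} · per_n` is characterized by its stabilizer in `SL_{m²}(ℂ)`**
(`n < m`, `m ≥ 3`) — the literal `G = SL(Y)` reading of GCT II Thm. 2.3 for its third form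
`f = φ(h) = y^{m-n} perm(X)` ("only almost excellent–because its defect of partial stability is
one"; §1: `V^{G_f̂} = ℂf`), and of the GCT Introduction, Lecture 13, Prop. [GCT1](3):
restatement for `slSubgroup` of
`CharacterizedByStabilizer.paddedPerPoly_eq_smul_of_fixed_of_det_eq_one`. Own elementary argument
deciding the literal reading (the degenerate sizes `m ≤ 2` are not treated).
[cite: MulmuleySohoniGCT2SIAM2008, §1 (definition) and Thm. 2.3 (arXiv cs/0612134 Thm. 3.3)]
[cite: MulmuleySohoniGCTIntro2007, Lecture 13, Prop. [GCT1](3)] -/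
theorem isCharacterizedByStabilizerIn_slSubgroup_paddedPerPoly {n m : ℕ} [NeZero m] (hnm : n < m)
    (hm : 3 ≤ m) :
    IsCharacterizedByStabilizerIn (slSubgroup (Fin m × Fin m) ℂ) (paddedPerPoly ℂ n m) m :=
  fun p hp hfix => CharacterizedByStabilizer.paddedPerPoly_eq_smul_of_fixed_of_det_eq_one hnm hm p hp
    fun γ hdet hpad => hfix γ (mem_slSubgroup_iff.mpr hdet) hpad

/-- `V^{SL_{m²} ∩ Stab(X₀₀^{m-n} per_n)} = ℂ · X₀₀^{m-n} per_n` for `n < m`, `m ≥ 3` (GCT II §1's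
`V^{G_v̂} = ℂv` with `G = SL(Y)`, `v̂ = φ(h)`).
[cite: MulmuleySohoniGCT2SIAM2008, §1 (definition) and Thm. 2.3] -/
theorem fixedForms_slSubgroup_paddedPerPoly_eq {n m : ℕ} [NeZero m] (hnm : n < m) (hm : 3 ≤ m) :
    fixedForms (slSubgroup (Fin m × Fin m) ℂ) (paddedPerPoly ℂ n m) m = ℂ ∙ paddedPerPoly ℂ n m :=
  (isCharacterizedByStabilizerIn_slSubgroup_paddedPerPoly hnm hm).fixedForms_eq
    (paddedPerPoly_isHomogeneous (le_of_lt hnm))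

end Literature.Computability.AlgebraicComplexity
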